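import Literature.MathematicalPhysics.QuantumFieldTheory.Balaban1983to89.B5G183RateTorusW
import Literature.MathematicalPhysics.QuantumFieldTheory.Balaban1983to89.B5Block118

/-!
# T⁴ programme, spine node NE2 (U1a) — BAŁABAN's OWN LINE-BLOCK AVERAGING (1.11)/(1.18) BETWEEN TWO LEVELS at `U = 1`:
# the straight-contour average is within `O(η)` of the identity on propagators, hence the ONE-STEP LAW
# `‖Q 𝒢^{(η/R)} Qᴴ − R^{−d}𝒢^{(η)}‖ ≤ R^{−d}·(CQ + 2d·Cst)·η` for `Q = ` Bałaban's averaging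

Eighth generation of the NE2 prover lineage P1 of the cell `pub-balaban`, file 2.  The lineage's accepted leaves prove the
one-step law for KING's componentwise block averaging `Q_R` ([King1986] (2.10); `B5G183RateTorusW.opNorm_Qavg_calG_rate`,
`‖Q_R 𝒢^{(η/R)} Q_Rᴴ − R^{−d}𝒢^{(η)}‖ ≤ R^{−d}·CQ(d,a)·η`).  Bałaban's averaging of VECTOR fields is different: a gauge field
is averaged over STRAIGHT CONTOURS and then over blocks — [Balaban1984PropagatorsI] (1.11) p. 19 «(QA)_c = Σ_{x∈B(c₋)}
L^{−(d+1)}A([x, x(c)])», (1.18) p. 20 «(Q_kA)_b = Σ_{x∈B^k(b₋)} η^{d+1}A([x, x(b)])» (tree: `B5Block118.QvOp`, level `n` →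
unit lattice).  Generation 7 recorded (leaf `B5QGQ171Unit`, record `t4/T4-EST-NE2-P1.md` §G7.0 (n)(o)) that THIS averaging,
not King's, is the positive object of [B5] p. 30 (`‖n^d·Q_k𝒢Q_kᴴ‖ = a⁻¹` exactly) and listed as the next mathematics «the
η-RATE of Q_k𝒢Q_k^* needs a two-level law for Bałaban's `QvOp`».  THIS FILE supplies that two-level law, in position
space, WITHOUT new Fourier analysis:

 * §1 (any finite torus `Tor Nf`, vector index `Fin d`): the own-direction translations `shiftT t` (`(S_tA)_μ(x) =
   A_μ(x + t e_μ)`; permutation matrices, `‖S_t‖ ≤ 1` by the Schur test), `S_{t+1} = S_t S_1`, `S_1 − 1 = Σ_μ P_μ(S^μ − 1)`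
   with `S^μ − 1 = c⁻¹∇^c_μ` (`B5Prop11Plancherel.fdiff`), hence the SMOOTHING LEMMAS `‖(S_1 − 1)X‖ ≤ d·C/|c|`,
   `‖(S_t − 1)X‖ ≤ t·d·C/|c|` from `‖∇_μX‖ ≤ C`; the STRAIGHT-CONTOUR AVERAGE `Lavg R = R⁻¹Σ_{t<R} S_t` («A([x, x(c)])»
   normalised), `‖Lavg‖ ≤ 1`, **`opNorm_Lavg_sub_one_mul_le`** `‖(Lavg − 1)X‖ ≤ R·d·C/|c|`;
 * §2 (two levels `N ← R·N` of the torus of periods `M`): **`QB N R M := Qavg N R M * Lavg R`** = Bałaban's one-step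
   averaging (1.11) in `η`-units between the lattices of spacings `η/R` and `η` (entries **`QB_apply`**: `R^{−(d+1)}·#{(j,t) :
   x′ = R·y + j + t e_μ}` on component `μ`, zero across components — (1.18) verbatim with `B^k(y) ↔` the `R`-block of `y`),
   `‖QB‖ ≤ R^{−d/2}`, **`opNorm_Lavg_conj_sub_le`** (`‖Lavg X Lavgᴴ − X‖ ≤ 2dC·η` when `‖∇X‖, ‖∇Xᴴ‖ ≤ C`), and the
   deliverable **`opNorm_QB_calG_rate`**: `‖QB 𝒢^{(η/R)} QBᴴ − R^{−d}•𝒢^{(η)}‖ ≤ R^{−d}·CQB(d,a)·η`, `CQB = CQ + 2d·Cst`, all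
   `N, R ≥ 1`, `a > 0`, every `d` and torus `M` — the hypothesis `OneStepAveragedLaw` of `Spine/CovariantAveragingTower` for
   Bałaban's averagings at `U = 1` (instantiated into a convergent tower in `Support/BalabanAveragedTowerUnit`).

MECHANISM (why no Fourier analysis is needed): `Lavg − 1` is an average of `S_t − 1 = Σ_{s<t} S_s(S_1 − 1)`, and `S_1 − 1`
is `η′·∇^{η′}` on each component (`η′ = η/R` the fine spacing), so `‖(Lavg − 1)𝒢′‖ ≤ R·d·η′·‖∇𝒢′‖ ≤ d·Cst·η` by the
printed UNIFORM bound (1.89) (`B5Prop11Plancherel.opNorm_fdiff_calG_le`): the contour average costs one derivative, which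
`𝒢` absorbs — the same mechanism as the averaging-weight defect `u_R − 1` in `B5G183RateTorusW` §7, now for the factor
`v_μ` of (1.61) seen in position space.

HONEST FRAMING (T4-DAG p. 1).  `U = 1`, FIXED FINITE torus, linear (Gaussian) layer, operator-norm currency; Bałaban PRINTS
NO RATE in `η` — (1.89) is η-uniform — so the rate statement and every constant are OURS ([folklore]); the `[B5]` locators
document which printed object is typed.  NOT `U ≠ 1` (the covariant averaging `Q(U)` and its one-step law are the open row
G-an2-4, typed as a hypothesis shape in `Spine/CovariantAveragingTower`), NOT infinite volume, NOT a mass gap, NOT Clay, NOT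
summit progress.  HONEST DEPENDENCY: continuum YM on T⁴ ⇐ BetaPertH ∧ nine spine estimates (0/9 proved); BetaPertH ⇐ (D1) ∧
(D4) ∧ CAP+tail; G-an2-4 gates asym, D1 and NE2/3/4.  ABSOLUTE RULE kept: inputs are kernel-proved tree modules only
(`B5G183RateTorusW` §7, `B5Prop11Plancherel`, `B5Block118`, `B5G183RateOp`/`L2Op` norm tools); no printed sentence is a
hypothesis; no `sorry`.
-/

noncomputable section

open scoped BigOperators ComplexConjugate Matrix Matrix.Norms.L2Operator
open Finset Complex

namespace Summit.QuantumFields.BalabanUV.T4Continuum.BalabanLineAverage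

open Literature.MathematicalPhysics.QuantumFieldTheory.Balaban1983to89.B5Prop11Plancherel
open Literature.MathematicalPhysics.QuantumFieldTheory.Balaban1983to89.B5Block118 (tstep tstep_zero tstep_succ)
open Literature.MathematicalPhysics.QuantumFieldTheory.Balaban1983to89.B5G183RateOp (opNorm_le_of_schur)
open Literature.MathematicalPhysics.QuantumFieldTheory.Balaban1983to89.B5G183RateL2Op (opNorm_diagonal_le)
open Literature.MathematicalPhysics.QuantumFieldTheory.Balaban1983to89.B5G183RateTorus (cpt CT_nonneg)
open Literature.MathematicalPhysics.QuantumFieldTheory.Balaban1983to89.B5G183RateTorusW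

variable {d : ℕ}

/-! ## §1 Own-direction translations and the straight-contour average on one torus -/

section Shifts

variable (Nf : Fin d → ℕ) [hNf : ∀ μ, NeZero (Nf μ)]

/-- the OWN-DIRECTION TRANSLATION by `t` lattice steps: `(S_t A)_μ(x) = A_μ(x + t e_μ)` (component `μ` is moved along
direction `μ`), a permutation matrix on `T × {1..d}`. [folklore] -/
def shiftT (t : ℕ) : Matrix (Tor Nf × Fin d) (Tor Nf × Fin d) ℂ :=
  fun i j => if j = (i.1 + tstep Nf i.2 t, i.2) then 1 else 0

/-- rows of `S_t X`: `(S_t X)_{(x,μ), b} = X_{(x + t e_μ, μ), b}`. [folklore] -/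
theorem shiftT_mul_apply {β : Type*} (t : ℕ) (X : Matrix (Tor Nf × Fin d) β ℂ) (i : Tor Nf × Fin d) (b : β) :
    (shiftT Nf t * X) i b = X (i.1 + tstep Nf i.2 t, i.2) b := by
  simp only [Matrix.mul_apply, shiftT, ite_mul, one_mul, zero_mul]
  rw [Finset.sum_ite_eq' Finset.univ (i.1 + tstep Nf i.2 t, i.2) (fun j => X j b)]
  simp

omit hNf in
/-- `S_0 = 1`. [folklore] -/
theorem shiftT_zero : shiftT Nf 0 = 1 := by
  ext i j
  simp only [shiftT, tstep_zero, add_zero, Prod.mk.eta, Matrix.one_apply]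
  by_cases h : i = j
  · simp [h]
  · rw [if_neg (fun hh => h hh.symm), if_neg h]

omit hNf in
/-- `e_μ = 1·e_μ`. [folklore] -/
theorem tstep_one (μ : Fin d) : tstep Nf μ 1 = unitVec Nf μ := by
  rw [tstep_succ, tstep_zero, zero_add]

/-- `S_{t+1} = S_t S_1`. [folklore] -/
theorem shiftT_succ (t : ℕ) : shiftT Nf (t + 1) = shiftT Nf t * shiftT Nf 1 := by
  ext i j
  rw [shiftT_mul_apply]
  simp only [shiftT, tstep_succ, tstep_zero, zero_add, add_assoc]

omit hNf in
/-- `S_t i = j ↔ i = S_{−t} j`: the translation is a bijection of the index set. [folklore] -/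
theorem shiftT_eq_iff (t : ℕ) (i j : Tor Nf × Fin d) :
    j = (i.1 + tstep Nf i.2 t, i.2) ↔ i = (j.1 - tstep Nf j.2 t, j.2) := by
  constructor
  · intro h
    rw [h]
    simp
  · intro h
    rw [h]
    simp

/-- `‖S_t‖ ≤ 1` (a permutation matrix: every row and every column has exactly one entry `1`; Schur test). [folklore] -/
theorem opNorm_shiftT_le (t : ℕ) : ‖shiftT Nf t‖ ≤ 1 := by
  refine opNorm_le_of_schur _ zero_le_one (fun i => ?_) (fun j => ?_)
  · simp only [shiftT]
    rw [Finset.sum_eq_single (i.1 + tstep Nf i.2 t, i.2)]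
    · simp
    · intro j _ hj; rw [if_neg hj, norm_zero]
    · intro h; exact absurd (Finset.mem_univ _) h
  · simp only [shiftT]
    simp_rw [shiftT_eq_iff Nf t _ j]
    rw [Finset.sum_eq_single (j.1 - tstep Nf j.2 t, j.2)]
    · simp
    · intro i _ hi; rw [if_neg hi, norm_zero]
    · intro h; exact absurd (Finset.mem_univ _) h

/-- the COMPONENT PROJECTOR `P_μ` (keep component `μ`, kill the others). [folklore] -/
def Pcomp (μ : Fin d) : Matrix (Tor Nf × Fin d) (Tor Nf × Fin d) ℂ :=
  Matrix.diagonal fun i => if i.2 = μ then 1 else 0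

/-- `‖P_μ‖ ≤ 1`. [folklore] -/
theorem opNorm_Pcomp_le (μ : Fin d) : ‖Pcomp Nf μ‖ ≤ 1 :=
  opNorm_diagonal_le _ zero_le_one fun i => by
    by_cases h : i.2 = μ
    · simp [h]
    · simp [h]

/-- **`S_1 − 1 = Σ_μ P_μ (S^μ − 1)`**: on component `μ` the own-direction translation is the ordinary translation `S^μ`
(`B5Prop11Plancherel.shiftM`, all components along direction `μ`). [folklore] -/
theorem shiftT_one_sub_one : shiftT Nf 1 - 1 = ∑ μ, Pcomp Nf μ * (shiftM Nf μ - 1) := by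
  ext i j
  rw [Matrix.sub_apply, Matrix.sum_apply]
  have h : ∀ μ, (Pcomp Nf μ * (shiftM Nf μ - 1)) i j = if i.2 = μ then (shiftM Nf μ - 1) i j else 0 := by
    intro μ
    rw [Pcomp, Matrix.diagonal_mul]
    split_ifs <;> simp
  simp_rw [h]
  rw [Finset.sum_ite_eq]
  simp only [Finset.mem_univ, if_true, Matrix.sub_apply, shiftT, shiftM, tstep_one]

omit hNf in
/-- `S^μ − 1 = c⁻¹·∇^c_μ` (`∇^c_μ = c·(S^μ − 1)`, `c = η⁻¹` the lattice factor of (1.31)). [cite: Balaban1984PropagatorsI,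
(1.31) p.23] [folklore] -/
theorem shiftM_sub_one_eq (μ : Fin d) {c : ℂ} (hc : c ≠ 0) : shiftM Nf μ - 1 = c⁻¹ • fdiff Nf c μ := by
  rw [fdiff, smul_smul, inv_mul_cancel₀ hc, one_smul]

/-- **smoothing lemma, one step**: `‖(S_1 − 1)X‖ ≤ d·C/|c|` whenever `‖∇^c_μ X‖ ≤ C` for all `μ`. [folklore] -/
theorem opNorm_shiftT_one_sub_one_mul_le (X : Matrix (Tor Nf × Fin d) (Tor Nf × Fin d) ℂ) {c : ℂ} (hc : c ≠ 0)
    {C : ℝ} (hX : ∀ μ, ‖fdiff Nf c μ * X‖ ≤ C) : ‖(shiftT Nf 1 - 1) * X‖ ≤ d * (C / ‖c‖) := by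
  rw [shiftT_one_sub_one, Finset.sum_mul]
  calc ‖∑ μ, Pcomp Nf μ * (shiftM Nf μ - 1) * X‖
      ≤ ∑ μ, ‖Pcomp Nf μ * (shiftM Nf μ - 1) * X‖ := norm_sum_le _ _
    _ ≤ ∑ _μ : Fin d, C / ‖c‖ := by
        refine Finset.sum_le_sum fun μ _ => ?_
        rw [Matrix.mul_assoc, shiftM_sub_one_eq Nf μ hc, Matrix.smul_mul]
        calc ‖Pcomp Nf μ * (c⁻¹ • (fdiff Nf c μ * X))‖
            ≤ ‖Pcomp Nf μ‖ * ‖c⁻¹ • (fdiff Nf c μ * X)‖ := Matrix.l2_opNorm_mul _ _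
          _ ≤ 1 * (‖c‖⁻¹ * C) := by
              rw [norm_smul, norm_inv]
              exact mul_le_mul (opNorm_Pcomp_le Nf μ)
                (mul_le_mul_of_nonneg_left (hX μ) (inv_nonneg.mpr (norm_nonneg _)))
                (mul_nonneg (inv_nonneg.mpr (norm_nonneg _)) (norm_nonneg _)) zero_le_one
          _ = C / ‖c‖ := by rw [one_mul, div_eq_inv_mul]
    _ = d * (C / ‖c‖) := by rw [Finset.sum_const, Finset.card_univ, Fintype.card_fin, nsmul_eq_mul]

/-- **smoothing lemma, `t` steps**: `‖(S_t − 1)X‖ ≤ t·d·C/|c|` (telescoping `S_{t+1} − 1 = S_t(S_1 − 1) + (S_t − 1)` and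
`‖S_t‖ ≤ 1`). [folklore] -/
theorem opNorm_shiftT_sub_one_mul_le (X : Matrix (Tor Nf × Fin d) (Tor Nf × Fin d) ℂ) {c : ℂ} (hc : c ≠ 0)
    {C : ℝ} (hX : ∀ μ, ‖fdiff Nf c μ * X‖ ≤ C) (t : ℕ) :
    ‖(shiftT Nf t - 1) * X‖ ≤ t * (d * (C / ‖c‖)) := by
  have h1 := opNorm_shiftT_one_sub_one_mul_le Nf X hc hX
  induction t with
  | zero => simp [shiftT_zero]
  | succ t ih =>
    have e : (shiftT Nf (t + 1) - 1) * X = shiftT Nf t * ((shiftT Nf 1 - 1) * X) + (shiftT Nf t - 1) * X := by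
      rw [shiftT_succ]
      simp only [Matrix.sub_mul, Matrix.mul_sub, Matrix.one_mul, Matrix.mul_assoc]
      abel
    rw [e]
    calc ‖shiftT Nf t * ((shiftT Nf 1 - 1) * X) + (shiftT Nf t - 1) * X‖
        ≤ ‖shiftT Nf t * ((shiftT Nf 1 - 1) * X)‖ + ‖(shiftT Nf t - 1) * X‖ := norm_add_le _ _
      _ ≤ 1 * (d * (C / ‖c‖)) + t * (d * (C / ‖c‖)) := by
          refine add_le_add ?_ ih
          exact (Matrix.l2_opNorm_mul _ _).trans
            (mul_le_mul (opNorm_shiftT_le Nf t) h1 (norm_nonneg _) zero_le_one)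
      _ = ((t + 1 : ℕ) : ℝ) * (d * (C / ‖c‖)) := by push_cast; ring

variable (R : ℕ) [NeZero R]

/-- the STRAIGHT-CONTOUR AVERAGE of length `R` («A([x, x(c)])» of (1.11)/(1.18), normalised by `R⁻¹`):
`(Lavg A)_μ(x) = R⁻¹ Σ_{t<R} A_μ(x + t e_μ)`. [cite: Balaban1984PropagatorsI, (1.11) p.19, (1.18) p.20] [folklore] -/
def Lavg : Matrix (Tor Nf × Fin d) (Tor Nf × Fin d) ℂ :=
  ((R : ℂ))⁻¹ • ∑ t : Fin R, shiftT Nf (t : ℕ)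

/-- `‖Lavg‖ ≤ 1` (an average of `R` contractions). [folklore] -/
theorem opNorm_Lavg_le : ‖Lavg Nf R‖ ≤ 1 := by
  have hR : (0 : ℝ) < R := by exact_mod_cast Nat.pos_of_ne_zero (NeZero.ne R)
  rw [Lavg, norm_smul, norm_inv, Complex.norm_natCast]
  calc (R : ℝ)⁻¹ * ‖∑ t : Fin R, shiftT Nf (t : ℕ)‖
      ≤ (R : ℝ)⁻¹ * ∑ t : Fin R, ‖shiftT Nf (t : ℕ)‖ :=
        mul_le_mul_of_nonneg_left (norm_sum_le _ _) (inv_nonneg.mpr hR.le)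
    _ ≤ (R : ℝ)⁻¹ * ∑ _t : Fin R, (1 : ℝ) :=
        mul_le_mul_of_nonneg_left (Finset.sum_le_sum fun t _ => opNorm_shiftT_le Nf t) (inv_nonneg.mpr hR.le)
    _ = 1 := by
        rw [Finset.sum_const, Finset.card_univ, Fintype.card_fin, nsmul_eq_mul, mul_one, inv_mul_cancel₀ hR.ne']

omit hNf in
/-- `Lavg − 1 = R⁻¹ Σ_{t<R} (S_t − 1)`. [folklore] -/
theorem Lavg_sub_one : Lavg Nf R - 1 = ((R : ℂ))⁻¹ • ∑ t : Fin R, (shiftT Nf (t : ℕ) - 1) := by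
  have hR : (R : ℂ) ≠ 0 := by exact_mod_cast NeZero.ne R
  rw [Finset.sum_sub_distrib, Finset.sum_const, Finset.card_univ, Fintype.card_fin, smul_sub, Lavg,
    ← Nat.cast_smul_eq_nsmul ℂ, smul_smul, inv_mul_cancel₀ hR, one_smul]

/-- **`‖(Lavg − 1)X‖ ≤ R·d·C/|c|`** whenever `‖∇^c_μX‖ ≤ C` for all `μ`: the contour average costs ONE derivative.  (With
`c = η′⁻¹ = R·η⁻¹` the fine lattice factor this is `d·C·η`.) [folklore] -/
theorem opNorm_Lavg_sub_one_mul_le (X : Matrix (Tor Nf × Fin d) (Tor Nf × Fin d) ℂ) {c : ℂ} (hc : c ≠ 0)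
    {C : ℝ} (hX : ∀ μ, ‖fdiff Nf c μ * X‖ ≤ C) : ‖(Lavg Nf R - 1) * X‖ ≤ R * (d * (C / ‖c‖)) := by
  have hR : (0 : ℝ) < R := by exact_mod_cast Nat.pos_of_ne_zero (NeZero.ne R)
  have hδ : 0 ≤ d * (C / ‖c‖) := by
    have h1 := opNorm_shiftT_one_sub_one_mul_le Nf X hc hX
    exact (norm_nonneg _).trans h1
  rw [Lavg_sub_one, Matrix.smul_mul, Finset.sum_mul, norm_smul, norm_inv, Complex.norm_natCast]
  calc (R : ℝ)⁻¹ * ‖∑ t : Fin R, (shiftT Nf (t : ℕ) - 1) * X‖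
      ≤ (R : ℝ)⁻¹ * ∑ t : Fin R, ‖(shiftT Nf (t : ℕ) - 1) * X‖ :=
        mul_le_mul_of_nonneg_left (norm_sum_le _ _) (inv_nonneg.mpr hR.le)
    _ ≤ (R : ℝ)⁻¹ * ∑ _t : Fin R, (R : ℝ) * (d * (C / ‖c‖)) := by
        refine mul_le_mul_of_nonneg_left (Finset.sum_le_sum fun t _ => ?_) (inv_nonneg.mpr hR.le)
        refine (opNorm_shiftT_sub_one_mul_le Nf X hc hX t).trans ?_
        exact mul_le_mul_of_nonneg_right (by exact_mod_cast (t.isLt).le) hδ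
    _ = R * (d * (C / ‖c‖)) := by
        rw [Finset.sum_const, Finset.card_univ, Fintype.card_fin, nsmul_eq_mul]
        field_simp

/-- two-sided version: `‖Lavg X Lavgᴴ − X‖ ≤ 2R·d·C/|c|` whenever `‖∇_μX‖ ≤ C` and `‖∇_μXᴴ‖ ≤ C` for all `μ`. [folklore] -/
theorem opNorm_Lavg_conj_sub_le (X : Matrix (Tor Nf × Fin d) (Tor Nf × Fin d) ℂ) {c : ℂ} (hc : c ≠ 0) {C : ℝ}
    (hX : ∀ μ, ‖fdiff Nf c μ * X‖ ≤ C) (hXH : ∀ μ, ‖fdiff Nf c μ * Xᴴ‖ ≤ C) :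
    ‖Lavg Nf R * X * (Lavg Nf R)ᴴ - X‖ ≤ 2 * (R * (d * (C / ‖c‖))) := by
  have e : Lavg Nf R * X * (Lavg Nf R)ᴴ - X
      = (Lavg Nf R - 1) * X * (Lavg Nf R)ᴴ + ((Lavg Nf R - 1) * Xᴴ)ᴴ := by
    rw [Matrix.conjTranspose_mul, Matrix.conjTranspose_conjTranspose, Matrix.conjTranspose_sub,
      Matrix.conjTranspose_one, Matrix.sub_mul, Matrix.one_mul, Matrix.sub_mul, Matrix.mul_sub, Matrix.mul_one,
      sub_add_sub_cancel]
  rw [e]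
  have h1 := opNorm_Lavg_sub_one_mul_le Nf R X hc hX
  have h2 := opNorm_Lavg_sub_one_mul_le Nf R Xᴴ hc hXH
  have h0 : 0 ≤ R * (d * (C / ‖c‖)) := (norm_nonneg _).trans h1
  calc ‖(Lavg Nf R - 1) * X * (Lavg Nf R)ᴴ + ((Lavg Nf R - 1) * Xᴴ)ᴴ‖
      ≤ ‖(Lavg Nf R - 1) * X * (Lavg Nf R)ᴴ‖ + ‖((Lavg Nf R - 1) * Xᴴ)ᴴ‖ := norm_add_le _ _
    _ ≤ R * (d * (C / ‖c‖)) * 1 + R * (d * (C / ‖c‖)) := by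
        refine add_le_add ?_ ?_
        · refine (Matrix.l2_opNorm_mul _ _).trans (mul_le_mul h1 ?_ (norm_nonneg _) h0)
          rw [Matrix.l2_opNorm_conjTranspose]
          exact opNorm_Lavg_le Nf R
        · rw [Matrix.l2_opNorm_conjTranspose]
          exact h2
    _ = 2 * (R * (d * (C / ‖c‖))) := by ring

end Shifts

/-! ## §2 Bałaban's one-step averaging between the levels `R·N → N` and its one-step law for `𝒢` at `U = 1` -/

section TwoLevel

variable (N R : ℕ) [NeZero N] [NeZero R] (M : Fin d → ℕ) [hM : ∀ μ, NeZero (M μ)]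

/-- **BAŁABAN's ONE-STEP AVERAGING between the lattices of spacings `η/R` and `η`** = King's `R`-block average of the
straight-contour average of length `R`: «(QA)_c = Σ_{x∈B(c₋)} L^{−(d+1)}A([x, x(c)])» with `L = R`, in `η`-units.
[cite: Balaban1984PropagatorsI, (1.11) p.19, (1.18) p.20] -/
def QB : Matrix (Tor (fine N M) × Fin d) (Tor (fine (R * N) M) × Fin d) ℂ :=
  Qavg N R M * Lavg (fine (R * N) M) R

/-- **the entries of `QB` are (1.11)/(1.18) verbatim**: `QB_{(y,μ),(x′,μ′)} = δ_{μμ′}·R^{−(d+1)}·#{(j, t) ∈ [0,R)^d × [0,R) :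
x′ = R y + j + t e_μ}` — the fine bonds of the straight contours `[x, x + R e_μ]`, `x` in the `R`-block of `y`, each with
weight `R^{−(d+1)}` (`= L^{−(d+1)}` of (1.11), `= η^{d+1}` of (1.18) in unit-lattice units). [cite: Balaban1984PropagatorsI,
(1.11) p.19, (1.18) p.20] -/
theorem QB_apply (i : Tor (fine N M) × Fin d) (x : Tor (fine (R * N) M) × Fin d) :
    QB N R M i x = ((R : ℂ) ^ (d + 1))⁻¹ *
      ∑ j : Fin d → Fin R, ∑ t : Fin R,
        (if x = (cpt N R M i.1 + off N R M j + tstep (fine (R * N) M) i.2 (t : ℕ), i.2) then 1 else 0) := by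
  rw [QB, Qavg_mul_apply]
  have hL : ∀ j : Fin d → Fin R, Lavg (fine (R * N) M) R (cpt N R M i.1 + off N R M j, i.2) x
      = ((R : ℂ))⁻¹ * ∑ t : Fin R,
        (if x = (cpt N R M i.1 + off N R M j + tstep (fine (R * N) M) i.2 (t : ℕ), i.2) then 1 else 0) := by
    intro j
    simp only [Lavg, Matrix.smul_apply, Matrix.sum_apply, shiftT, smul_eq_mul]
  simp_rw [hL]
  rw [← Finset.mul_sum, ← mul_assoc, pow_succ, mul_inv]

/-- `‖QB‖ ≤ R^{−d/2}` (`‖Q_R‖ ≤ R^{−d/2}`, `‖Lavg‖ ≤ 1`). [folklore] -/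
theorem opNorm_QB_le : ‖QB N R M‖ ≤ (Real.sqrt ((R : ℝ) ^ d))⁻¹ := by
  refine (Matrix.l2_opNorm_mul _ _).trans ?_
  calc ‖Qavg N R M‖ * ‖Lavg (fine (R * N) M) R‖ ≤ (Real.sqrt ((R : ℝ) ^ d))⁻¹ * 1 :=
        mul_le_mul (opNorm_Qavg_le N R M) (opNorm_Lavg_le _ R) (norm_nonneg _)
          (inv_nonneg.mpr (Real.sqrt_nonneg _))
    _ = (Real.sqrt ((R : ℝ) ^ d))⁻¹ := mul_one _

/-- `‖QB‖² ≤ R^{−d}` (the form the tower consumes). [folklore] -/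
theorem opNorm_QB_sq_le : ‖QB N R M‖ ^ 2 ≤ ((R : ℝ) ^ d)⁻¹ := by
  have hRd : (0 : ℝ) ≤ (R : ℝ) ^ d := pow_nonneg (Nat.cast_nonneg _) d
  calc ‖QB N R M‖ ^ 2 ≤ ((Real.sqrt ((R : ℝ) ^ d))⁻¹) ^ 2 := pow_le_pow_left₀ (norm_nonneg _) (opNorm_QB_le N R M) 2
    _ = ((R : ℝ) ^ d)⁻¹ := by rw [inv_pow, Real.sq_sqrt hRd]

omit [NeZero N] [NeZero R] hM in
/-- the constant of the one-step law for Bałaban's averaging: King-side `CQ` plus the contour-average defect `2d·Cst`.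
Constant OURS. [folklore] -/
def CQB (d : ℕ) (a : ℝ) : ℝ := CQ d a + 2 * d * Cst d a

omit [NeZero N] [NeZero R] hM in
/-- `0 ≤ CQB`. [folklore] -/
theorem CQB_nonneg (d : ℕ) (a : ℝ) : 0 ≤ CQB d a := by
  have h1 : 0 ≤ CQ d a := by
    have := CT_nonneg d a
    have := Cst_nonneg d a
    rw [CQ]; positivity
  have h2 := Cst_nonneg d a
  rw [CQB]; positivity

/-- **THE ONE-STEP LAW FOR BAŁABAN's AVERAGING at `U = 1`** (finite torus, all `N, R ≥ 1`, `a > 0`, every `d`):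
`‖QB 𝒢^{(η/R)} QBᴴ − R^{−d}•𝒢^{(η)}‖ ≤ R^{−d}·CQB(d,a)·η` — the (1.11)/(1.18)-averages of the fine-lattice Landau-type
propagator `𝒢 = Δ_a^{−1}` (1.83) ARE the coarse-lattice propagator up to `O(η)`.  Assembled from the lineage's law for King's
`Q_R` (`opNorm_Qavg_calG_rate`) and the smoothing lemma with the printed uniform bound `‖∇𝒢‖ ≤ Cst` (1.89).  Bałaban prints
no rate; statement and constant OURS. [cite: Balaban1984PropagatorsI, (1.11) p.19, (1.18) p.20, Prop. 1.1 (1.89) p.33;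
King1986, (2.10) p.653, Lemma 4.5 (4.38) p.674 (scalar template)] [folklore] -/
theorem opNorm_QB_calG_rate (hN : 1 ≤ N) (hR : 1 ≤ R) (hRN : 1 ≤ R * N) (a : ℝ) (ha : 0 < a) :
    ‖QB N R M * calG (R * N) hRN M a ha * (QB N R M)ᴴ - ((R : ℂ) ^ d)⁻¹ • calG N hN M a ha‖
      ≤ ((R : ℝ) ^ d)⁻¹ * CQB d a / N := by
  have hNpos : (0 : ℝ) < N := by exact_mod_cast hN
  have hRpos : (0 : ℝ) < R := by exact_mod_cast hR
  have hRd : (0 : ℝ) < (R : ℝ) ^ d := pow_pos hRpos d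
  have hc : (((R * N : ℕ) : ℂ)) ≠ 0 := by exact_mod_cast (Nat.pos_iff_ne_zero.mp hRN)
  have hcn : ‖(((R * N : ℕ) : ℂ))‖ = (R : ℝ) * N := by rw [Complex.norm_natCast]; push_cast; ring
  set G' := calG (R * N) hRN M a ha with hG'
  set Lv := Lavg (fine (R * N) M) R with hLv
  -- the smoothing estimate for `𝒢′` (Hermitian, `‖∇𝒢′‖ ≤ Cst`)
  have hX : ∀ μ, ‖fdiff (fine (R * N) M) ((R * N : ℕ) : ℂ) μ * G'‖ ≤ Cst d a :=
    fun μ => opNorm_fdiff_calG_le (R * N) hRN M a ha μ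
  have hXH : ∀ μ, ‖fdiff (fine (R * N) M) ((R * N : ℕ) : ℂ) μ * G'ᴴ‖ ≤ Cst d a := by
    intro μ; rw [(calG_isHermitian (R * N) hRN M a ha).eq]; exact hX μ
  have hsm : ‖Lv * G' * Lvᴴ - G'‖ ≤ 2 * d * Cst d a / N := by
    refine (opNorm_Lavg_conj_sub_le (fine (R * N) M) R G' hc hX hXH).trans (le_of_eq ?_)
    rw [hcn]
    field_simp
  -- split
  have e : QB N R M * G' * (QB N R M)ᴴ - ((R : ℂ) ^ d)⁻¹ • calG N hN M a ha
      = Qavg N R M * (Lv * G' * Lvᴴ - G') * (Qavg N R M)ᴴ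
        + (Qavg N R M * G' * (Qavg N R M)ᴴ - ((R : ℂ) ^ d)⁻¹ • calG N hN M a ha) := by
    rw [QB, Matrix.conjTranspose_mul, Matrix.mul_sub, Matrix.sub_mul]
    simp only [Matrix.mul_assoc]
    abel
  rw [e]
  have hQ := opNorm_Qavg_le N R M
  have hQt : ‖(Qavg N R M)ᴴ‖ ≤ (Real.sqrt ((R : ℝ) ^ d))⁻¹ := by rw [Matrix.l2_opNorm_conjTranspose]; exact hQ
  have hc0 : 0 ≤ (Real.sqrt ((R : ℝ) ^ d))⁻¹ := inv_nonneg.mpr (Real.sqrt_nonneg _)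
  have hcc : (Real.sqrt ((R : ℝ) ^ d))⁻¹ * (Real.sqrt ((R : ℝ) ^ d))⁻¹ = ((R : ℝ) ^ d)⁻¹ := by
    rw [← mul_inv, Real.mul_self_sqrt hRd.le]
  have hsm0 : 0 ≤ 2 * d * Cst d a / N := by have := Cst_nonneg d a; positivity
  have hT1 : ‖Qavg N R M * (Lv * G' * Lvᴴ - G') * (Qavg N R M)ᴴ‖ ≤ ((R : ℝ) ^ d)⁻¹ * (2 * d * Cst d a / N) := by
    calc ‖Qavg N R M * (Lv * G' * Lvᴴ - G') * (Qavg N R M)ᴴ‖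
        ≤ ‖Qavg N R M‖ * ‖Lv * G' * Lvᴴ - G'‖ * ‖(Qavg N R M)ᴴ‖ :=
          (Matrix.l2_opNorm_mul _ _).trans (mul_le_mul_of_nonneg_right (Matrix.l2_opNorm_mul _ _) (norm_nonneg _))
      _ ≤ (Real.sqrt ((R : ℝ) ^ d))⁻¹ * (2 * d * Cst d a / N) * (Real.sqrt ((R : ℝ) ^ d))⁻¹ :=
          mul_le_mul (mul_le_mul hQ hsm (norm_nonneg _) hc0) hQt (norm_nonneg _) (mul_nonneg hc0 hsm0)
      _ = ((R : ℝ) ^ d)⁻¹ * (2 * d * Cst d a / N) := by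
          rw [mul_comm _ (2 * d * Cst d a / N), mul_assoc, hcc, mul_comm]
  have hT2 := opNorm_Qavg_calG_rate N R M hN hR hRN a ha
  calc _ ≤ _ := norm_add_le _ _
    _ ≤ ((R : ℝ) ^ d)⁻¹ * (2 * d * Cst d a / N) + ((R : ℝ) ^ d)⁻¹ * CQ d a / N := add_le_add hT1 hT2
    _ = ((R : ℝ) ^ d)⁻¹ * CQB d a / N := by rw [CQB]; ring

/-- the same with the `R^{−d}` dropped (`R ≥ 1`). [folklore] -/
theorem opNorm_QB_calG_rate' (hN : 1 ≤ N) (hR : 1 ≤ R) (hRN : 1 ≤ R * N) (a : ℝ) (ha : 0 < a) :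
    ‖QB N R M * calG (R * N) hRN M a ha * (QB N R M)ᴴ - ((R : ℂ) ^ d)⁻¹ • calG N hN M a ha‖ ≤ CQB d a / N := by
  have hNpos : (0 : ℝ) < N := by exact_mod_cast hN
  have hR1 : (1 : ℝ) ≤ (R : ℝ) ^ d := one_le_pow₀ (by exact_mod_cast hR)
  refine (opNorm_QB_calG_rate N R M hN hR hRN a ha).trans ?_
  rw [mul_div_assoc]
  exact mul_le_of_le_one_left (div_nonneg (CQB_nonneg d a) hNpos.le) (inv_le_one_of_one_le₀ hR1)

end TwoLevel

end Summit.QuantumFields.BalabanUV.T4Continuum.BalabanLineAverage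

end
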